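import Mathlib.Analysis.Convex.Basic
import Mathlib.Analysis.Convex.Segment
import Mathlib.Topology.Algebra.Affine
import Mathlib.Analysis.Normed.Affine.AddTorsor
import Mathlib.Topology.EMetricSpace.Lipschitz
import Mathlib.Topology.Order.IntermediateValue
import Mathlib.Topology.LocallyFinite
import HarnessLib

/-!
# Piecewise Lipschitz maps are Lipschitz on convex sets

Let a map `w` be `K`-Lipschitz on each of finitely many *closed* sets `A i` of a real normed
space. Then along every segment covered by the `A i` the endpoints satisfy
`dist (w x) (w y) ≤ K * dist x y` (`dist_le_mul_of_segment_subset_iUnion`), so `w` is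
`K`-Lipschitz on every convex set covered by the `A i` (`lipschitzOnWith_of_convex_subset_iUnion`).
No convexity of the pieces is needed: the proof is a continuous induction along the segment
(Mathlib's `IsClosed.mem_of_ge_of_forall_exists_gt`) — at each parameter some piece contains
both the current point and points slightly further on.

This is the elementary step by which simplexwise `C¹`-small perturbations of the identity on a
finite simplicial complex are globally bi-Lipschitz on convex regions (Munkres, *Elementary
differential topology* (1966), proofs of 8.5–8.8), used for the fitting together of smooth
triangulations. [folklore]
-/

open Set Function Filter
open scoped NNReal Topology

noncomputable section

namespace Literature.Analysis.Calculus

variable {E : Type*} [NormedAddCommGroup E] [NormedSpace ℝ E] {F : Type*} [PseudoMetricSpace F]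
  {ι : Type*} [Finite ι] {A : ι → Set E} {K : ℝ≥0} {w : E → F}

/-- **Piecewise Lipschitz along a segment.** If `w` is `K`-Lipschitz on each of finitely many
closed sets covering the segment `[x, y]`, then `dist (w x) (w y) ≤ K * dist x y`. [folklore] -/
theorem dist_le_mul_of_segment_subset_iUnion (hA : ∀ i, IsClosed (A i))
    (hw : ∀ i, LipschitzOnWith K w (A i)) {x y : E} (hxy : segment ℝ x y ⊆ ⋃ i, A i) :
    dist (w x) (w y) ≤ K * dist x y := by
  classical
  -- parametrise the segment
  set γ : ℝ → E := fun t => AffineMap.lineMap x y t with hγ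
  have hγc : Continuous γ := AffineMap.lineMap_continuous
  have hγseg : ∀ t ∈ Icc (0 : ℝ) 1, γ t ∈ segment ℝ x y := fun t ht => by
    rw [segment_eq_image_lineMap]
    exact ⟨t, ht, rfl⟩
  have hγdist : ∀ s t : ℝ, dist (γ s) (γ t) = dist s t * dist x y := fun s t =>
    dist_lineMap_lineMap x y s t
  -- continuity of `w ∘ γ` on `[0, 1]`
  have hwc : ContinuousOn w (⋃ i, A i) :=
    (locallyFinite_of_finite A).continuousOn_iUnion (fun i => hA i) fun i => (hw i).continuousOn
  have hwγ : ContinuousOn (fun t => w (γ t)) (Icc 0 1) :=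
    hwc.comp hγc.continuousOn fun t ht => hxy (hγseg t ht)
  -- the set of good parameters
  set S : Set ℝ := {t | dist (w x) (w (γ t)) ≤ K * (t * dist x y)} with hS
  have hγ0 : γ 0 = x := AffineMap.lineMap_apply_zero x y
  have hγ1 : γ 1 = y := AffineMap.lineMap_apply_one x y
  suffices h1 : (1 : ℝ) ∈ S by
    have := h1
    simp only [hS, mem_setOf_eq, hγ1, one_mul] at this
    exact this
  refine IsClosed.mem_of_ge_of_forall_exists_gt ?_ ?_ zero_le_one ?_
  · -- closedness of `S ∩ [0, 1]`
    have : S ∩ Icc 0 1 = Icc 0 1 ∩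
        (fun t => dist (w x) (w (γ t)) - K * (t * dist x y)) ⁻¹' Iic 0 := by
      ext t
      simp only [hS, mem_inter_iff, mem_setOf_eq, mem_preimage, mem_Iic, sub_nonpos]
      tauto
    rw [this]
    refine ContinuousOn.preimage_isClosed_of_isClosed ?_ isClosed_Icc isClosed_Iic
    exact ((continuous_const.dist continuous_id).comp_continuousOn hwγ).sub
      (continuousOn_const.mul (continuousOn_id.mul continuousOn_const))
  · simp [hS, hγ0]
  · rintro c ⟨hcS, hc0, hc1⟩
    -- some piece contains `γ c` and a point `γ t` with `c < t ≤ 1`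
    obtain ⟨i, hci, t, ⟨hct, ht1⟩, hti⟩ :
        ∃ i, γ c ∈ A i ∧ ∃ t ∈ Ioc c 1, γ t ∈ A i := by
      by_contra hcon
      push Not at hcon
      set U : Set E := ⋂ i ∈ {i | γ c ∉ A i}, (A i)ᶜ with hU
      have hUo : IsOpen U := (Set.toFinite _).isOpen_biInter fun i _ => (hA i).isOpen_compl
      have hcU : γ c ∈ U := by
        simp only [hU, mem_iInter, mem_setOf_eq, mem_compl_iff]
        exact fun i hi => hi
      -- parameters slightly beyond `c` stay in `U`
      have hev : ∀ᶠ t in 𝓝 c, γ t ∈ U := hγc.continuousAt.preimage_mem_nhds (hUo.mem_nhds hcU)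
      obtain ⟨t, ⟨hct, htU⟩, ht1⟩ : ∃ t, (c < t ∧ γ t ∈ U) ∧ t ≤ 1 := by
        have h2 : ∀ᶠ t in 𝓝[>] c, γ t ∈ U ∧ t ≤ 1 :=
          (hev.filter_mono nhdsWithin_le_nhds).and
            (eventually_of_mem (Ioc_mem_nhdsGT hc1) fun t ht => ht.2)
        obtain ⟨t, ht, hct⟩ := (h2.and self_mem_nhdsWithin).exists
        exact ⟨t, ⟨hct, ht.1⟩, ht.2⟩
      obtain ⟨j, htj⟩ : ∃ j, γ t ∈ A j := by
        have := hxy (hγseg t ⟨hc0.trans hct.le, ht1⟩)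
        simpa only [mem_iUnion] using this
      by_cases hcj : γ c ∈ A j
      · exact hcon j hcj t ⟨hct, ht1⟩ htj
      · have : γ t ∈ (A j)ᶜ := by
          simp only [hU, mem_iInter, mem_setOf_eq] at htU
          exact htU j hcj
        exact this htj
    refine ⟨t, ?_, hct, ht1⟩
    -- the estimate propagates from `c` to `t` inside the piece `A i`
    have h1 : dist (w (γ c)) (w (γ t)) ≤ K * dist (γ c) (γ t) := (hw i).dist_le_mul _ hci _ hti
    rw [hγdist, Real.dist_eq, abs_of_nonpos (by linarith), neg_sub] at h1
    calc dist (w x) (w (γ t)) ≤ dist (w x) (w (γ c)) + dist (w (γ c)) (w (γ t)) :=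
          dist_triangle _ _ _
      _ ≤ K * (c * dist x y) + K * ((t - c) * dist x y) := add_le_add hcS h1
      _ = K * (t * dist x y) := by ring

/-- **Piecewise Lipschitz maps are Lipschitz on convex sets.** If `w` is `K`-Lipschitz on each
of finitely many closed sets, it is `K`-Lipschitz on every convex set covered by them.
[folklore] -/
theorem lipschitzOnWith_of_convex_subset_iUnion (hA : ∀ i, IsClosed (A i))
    (hw : ∀ i, LipschitzOnWith K w (A i)) {C : Set E} (hC : Convex ℝ C) (hCA : C ⊆ ⋃ i, A i) :
    LipschitzOnWith K w C :=
  LipschitzOnWith.of_dist_le_mul fun _ hx _ hy =>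
    dist_le_mul_of_segment_subset_iUnion hA hw ((hC.segment_subset hx hy).trans hCA)

end Literature.Analysis.Calculus
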